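import Summits.QuantumFields.YangMills.Theorems.BalabanUVNodesN19ConstantsWindow
import Summits.QuantumFields.YangMills.Theorems.BalabanUVNodesN27SpineRecordJoinSync
import HarnessLib

/-!
# BalabanUVNodes ∕ N19 constants window, node U2's OUTPUT letter — the knit v3 of `BalabanUVNodesN19ConstantsWindow` with N17
# entering through node U2's OUTPUT `InjectedRate Cd 0 θc disc` (the letter of the N27 join of record), as a corollary of the
# join's synchronised v2 `BalabanUVNodesN27SpineRecordJoinSync.core_summable_of_nodes_polySize_sync` (cell `pub-ymgap`, D-0062
# Track A, cluster K5, seat dag-n19-a gen 2; count-neutral)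

HONEST FRAMING.  One fixed finite four-torus, rung (B)+1 — NOT infinite volume, NOT a mass gap, NOT the Clay problem.  NE7
(node U5; NE7-proper leaf `Spine.NE7.Core`) is NOT PRINTED in [Balaban1987RG1]–[Balaban1989LargeFieldII] and NOT PROVED here.
Every analytic input is a HYPOTHESIS SHAPE of the tree consumed BY NAME; nothing of Bałaban's objects is instantiated; no
`def`, 0 `sorry`, standard axioms.  NOT a node discharge: a `--supports` helper for crux `SpineGivenEndpoint` (19182).

WHY THIS FILE.  The N27 join at the datum (dag-n27-a) reads N19 in node U2's OUTPUT letter; its synchronised form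
`BalabanUVNodesN27SpineRecordJoinSync` already transports the knit v2 of `BalabanUVNodesN19CentreSync` to that letter
(`core_summable_of_nodes_polySize_sync`: hazard H-U5b-1 for the E-LEDGER replaced by `hone` + the other-kinds centre clause
(O′); constants' rate `abs_const_sub_le_tower_of_injectedRate`) — CITED here, not restated.  This file adds the OUTPUT-LETTER
form of the knit v3 (`BalabanUVNodesN19ConstantsWindow.core_summable_of_spineNodes_window`): the EXTRACTED VACUUM-ENERGY
CONSTANTS' half of (O′) supplied by the in-edges by name — the other kinds written `o = exp(Σ_{ledger}E(·;g,1))·o′`, a τ-free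
reference ledger `All K ⊇ ledger` with the full-torus (0.26) multiplicity (which also DERIVES the ledger's scale ∕ multiplicity
binders), the BOOKING `RecentOnly (All K ∖ ledger) scale (jlog K) K` of the good class, AND — new here — the two runs'
MAIN-ACTION readings `exp(−R.act K v)`, `exp(−R.act (K+1) v)` peeled off the other kinds and matched by N16's OWN `ActionRate`
conjunct (`NE3Shape.action`, so far unused by every N19 knit: `|R.act (K+1) v − R.act K v| ≤ C₃θ₃^K·R.vol`, a rate with centre
`0`), the centre clause being asked only of the REMAINING kinds `o′` — so that the join's `hLink` sheds constants and action:
* §1 `core_summable_of_nodes_window` — N16 `NE3Shape` (+ `GaugeDominated`) · N18 `NE5` · N22 `NE9 ∧ FadingMemory` · N17 through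
  `InjectedRate Cd 0 θc disc` on the box · printed bracket · window · common rate (`1 ≤ Λ` for the log window) · format ·
  reference ledger + booking · `R.vol ≤ vol` · zero-centred size binder · (O″) for `o′` · `hone` ⇒
  `∃ δ, Spine.NE7.Core l₀ vol T Bad A B δ ∧ Summable δ` (proof: the join's synchronised v2 with
  `cO := Σ_{ledger}(E^B(·;1_B) − E^A(·;1_A)) + cO′`, `RO := RO′ + vol·C₃θ₃^K`; the excluded constants by
  `N19ConstantsWindow.abs_sum_const_le_windowSum`, `summable_windowSum_log`; the action by `h16.action`, `Σ C₃θ₃^K < ∞`).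
* §2 `nodes_window_nonvacuous` — non-vacuity on the tree's toy nodes (`T4TowerRateDischarge.toy_nodes_hypotheses`: constant
  coupling tables, U2's output with `Cd = 0`; any NE5 constant `C₅ ≥ 0`).
For the K5 author: relative to the join's `hLink`, `hsc hM hO hRO hrO hcO` are replaced by `hAll hAllsc hMAll hCl hrecent hOfmtA
hOfmtB hposO′ hRvol hO′ hRO′ hrO′ hcO′` (+ `1 ≤ Λ`).

BINDER CENSUS (as in `BalabanUVNodesN19ConstantsWindow`).  By name from N16 · N17 (through U2's output) · N18 · N22 + `hone`: the
driven-background rate, the ledger's constants, the EXCLUDED constants.  Remaining: (F) term format + reference ledger + booking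
(object-bound, NODE O); (O″) the remaining kinds (R-kind, boundary, run B's first step, N14's D-terms, LF normalization constants,
pending ∕ insert kinds — sibling rows NE-R1 ∕ `T4BoundaryRate` ∕ `Spine/NE1p` ∕ NE7b-c); (S)(M)(T) printed-grade.  By name now:
N16 = `NE3Shape` in BOTH conjuncts (`pointwise` → the argument bracket, `action` → the main action), N17, N18, N22.

CITATION HEADER (LOCATIONS only, as transcribed in the imported modules; no decl carries a cite tag).  [Balaban1988Convergent]
T. Bałaban, CMP **119** (1988) 243–285 — (2.25)–(2.27) p. 259, p. 262, Thm 2 (2.43) p. 263.  [Balaban1987RG1] CMP **109** (1987)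
249–301 — (0.26) p. 257, Thm 1 p. 259.  [Balaban1989LargeFieldII] CMP **122** (1989) 355–392 — p. 356, p. 380.  [King1986] CMP
**102** (1986) 649–677, (3.10)–(3.13).
-/

open Finset MeasureTheory

namespace Summit.QuantumFields.YangMills.BalabanUVNodes.N19ConstantsWindowU2Output

open Literature.MathematicalPhysics.QuantumFieldTheory.Balaban1983to89
open T4OutputRate T4RecentScale T4GoodClassBudget T4CauchySum T4TowerRateComposition T4TowerRateDischarge
open T4EtaRateMin (Readings LocalRate NE3Shape)
open T4RateLiaison (GaugeDominated)
open Summit.QuantumFields.BalabanUV.T4Continuum.Spine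
open Summit.QuantumFields.YangMills.BalabanUVNodes.N19CoreKnit
open Summit.QuantumFields.YangMills.BalabanUVNodes.N19CentreSync
open Summit.QuantumFields.YangMills.BalabanUVNodes.N19ConstantsWindow
open Summit.QuantumFields.YangMills.Theorems.BalabanUVNodesN27SpineRecord
  (abs_const_sub_le_tower_of_injectedRate core_summable_of_nodes_polySize_sync)

variable {C : Carriers} [DecidableEq C.Dom] {ι X : Type} [MeasurableSpace ι] {σ : Type*} [DecidableEq σ] {l₀ vol : ℝ}
  {T : ℕ → Finset σ} {Bad : ℕ → ℝ → Finset σ} {A B : ℕ → ℝ → σ → ℝ} {μ : ℕ → ℝ → σ → Measure ι}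
  {fac : ℕ → ℝ → σ → Finset C.Dom} {All : ℕ → Finset C.Dom} {R : Readings ι X} {W : Set (ℕ → ℝ)}
  {EA : Functional C C.BgA} {EB : Functional C C.BgB} {κ θ₅ C₅ C₉ ω θc Cd γ C₃ θ₃ Pg θ' Cl : ℝ} {q m : ℕ}
  {Λm : ℕ → ℕ → ℝ} {CU : (ℕ → ℝ) → ℕ → ℝ} {g : ℕ → ℕ → ℝ} {uA : ℕ → ι → C.BgA} {uB : ℕ → ι → C.BgB}
  {oneA : C.BgA} {oneB : C.BgB} {oA oB oA' oB' : ℕ → ℝ → σ → ι → ℝ} {S : ℕ → ℝ → σ → ℕ → ℝ}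
  {cO RO cO' RO' : ℕ → ℝ → σ → ℝ} {rO rO' : ℕ → ℝ} {Cw E₀ a Λ : ℝ}

/-! ## §1 The knit v3 in node U2's OUTPUT letter (a corollary of the N27 join's synchronised v2 and `N19ConstantsWindow` §1) -/

/-- **N19 KNIT v3, U2-OUTPUT LETTER** (`N19ConstantsWindow.core_summable_of_spineNodes_window` with N17 entering as node U2's
output): as the N27 join's synchronised knit `BalabanUVNodesN27SpineRecord.core_summable_of_nodes_polySize_sync` (dag-n27-a,
= `N19CentreSync.core_summable_of_spineNodes_sync` in the output letter), but the ledger's scales ∕ multiplicity DERIVED from a `τ`-free reference ledger `All K ⊇ fac K t τ` with full-torus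
(0.26) multiplicity, the other kinds written `o = exp(Σ_{fac}E(·;g,1))·o′`, the BOOKING `RecentOnly (All K ∖ fac K t τ) scale
(jlog_{Cl} K) K` (`0 ≤ Cl`, `1 ≤ Λ`), the two runs' MAIN-ACTION readings `exp(−R.act K v)` ∕ `exp(−R.act (K+1) v)` peeled
off as well — matched by N16's OWN `ActionRate` conjunct (`h16.action`: `|R.act (K+1) v − R.act K v| ≤ C₃θ₃^K·R.vol`, `R.vol ≤ vol`)
— and the centre clause asked only of the remaining kinds `o′` ⇒
`∃ δ, Spine.NE7.Core l₀ vol T Bad A B δ ∧ Summable δ`.  Proof: that knit with `cO := Σ_{fac}(E^B(·;1_B) − E^A(·;1_A)) + cO′`; the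
excluded constants by `N19ConstantsWindow.abs_sum_const_le_windowSum` with the constant of
`BalabanUVNodesN27SpineRecord.abs_const_sub_le_tower_of_injectedRate`, `summable_windowSum_log`.
CONDITIONAL on every binder; NOT NE7. [folklore] -/
theorem core_summable_of_nodes_window
    (h16 : NE3Shape R C₃ θ₃) (hC₃ : 0 ≤ C₃) (hgd : GaugeDominated R uA uB)
    (h18 : NE5 EA EB W κ θ₅ C₅) (hθ₅ : 0 ≤ θ₅) (hC₅ : 0 ≤ C₅)
    (h22 : NE9 EA W κ Λm ∧ T4OutputRate.FadingMemory C₉ ω Λm) (hω : 0 ≤ ω)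
    (hinj : InjectedRate Cd 0 θc (fun K j => T4CouplingMatching.disc (g K) (g (K + 1)) j)) (hCd : 0 ≤ Cd)
    (hθc : 0 ≤ θc) (hbox : ∀ K i, i ≤ K → 0 < g K i ∧ g K i ≤ γ)
    (hU : LipBackground EA W κ CU) (hG : PolyLipGrowth CU g Pg q) (hPg : 0 ≤ Pg)
    (hgA : ∀ K, g K ∈ W) (hgB : ∀ K, (fun i => g (K + 1) (i + 1)) ∈ W)
    (hθ' : max ω θc < θ') (hθ₅' : θ₅ ≤ θ') (hθ₃' : θ₃ ≤ θ') (hθ'1 : θ' < 1) (hθ'Λ : θ' ≤ Λ) (hΛ1 : 1 ≤ Λ)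
    (hfmtA : ∀ K t τ, A K t τ = ∫ v, (∏ X ∈ fac K t τ,
      Real.exp (EA (g K) (uA K v) X - EA (g K) oneA X)) * oA K t τ v ∂(μ K t τ))
    (hfmtB : ∀ K t τ, B K t τ = ∫ v, (∏ X ∈ fac K t τ,
      Real.exp (EB (fun i => g (K + 1) (i + 1)) (uB K v) X - EB (fun i => g (K + 1) (i + 1)) oneB X)) *
        oB K t τ v ∂(μ K t τ))
    (hint : ∀ K t, |t| ≤ l₀ → ∀ τ ∈ T K \ Bad K t,
      Integrable (fun v => (∏ X ∈ fac K t τ, Real.exp (EA (g K) (uA K v) X - EA (g K) oneA X)) *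
        oA K t τ v) (μ K t τ) ∧
      Integrable (fun v => (∏ X ∈ fac K t τ,
        Real.exp (EB (fun i => g (K + 1) (i + 1)) (uB K v) X - EB (fun i => g (K + 1) (i + 1)) oneB X)) *
        oB K t τ v) (μ K t τ))
    (hoff : ∀ K t, |t| ≤ l₀ → ∀ τ ∈ T K \ Bad K t, ∀ v, v ∉ R.dom →
      (∏ X ∈ fac K t τ, Real.exp (EA (g K) (uA K v) X - EA (g K) oneA X)) * oA K t τ v = 0 ∧
      (∏ X ∈ fac K t τ,
        Real.exp (EB (fun i => g (K + 1) (i + 1)) (uB K v) X - EB (fun i => g (K + 1) (i + 1)) oneB X)) *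
        oB K t τ v = 0)
    (hAll : ∀ K t, |t| ≤ l₀ → ∀ τ ∈ T K \ Bad K t, fac K t τ ⊆ All K)
    (hAllsc : ∀ K, ∀ X ∈ All K, C.scale X ≤ K)
    (hMAll : ∀ K, Multiplicity (All K) C.scale (fun X => Real.exp (-(κ * C.d X))) Cw vol Λ K)
    (hCl : 0 ≤ Cl)
    (hrecent : ∀ K t, |t| ≤ l₀ → ∀ τ ∈ T K \ Bad K t, RecentOnly (All K \ fac K t τ) C.scale (jlogOf Cl K) K)
    -- the other kinds CARRY the extracted constants of the ledger AND the two runs' main-action readings `R.act`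
    (hOfmtA : ∀ K t τ v, oA K t τ v =
      Real.exp (∑ X ∈ fac K t τ, EA (g K) oneA X) * (Real.exp (-(R.act K v)) * oA' K t τ v))
    (hOfmtB : ∀ K t τ v, oB K t τ v =
      Real.exp (∑ X ∈ fac K t τ, EB (fun i => g (K + 1) (i + 1)) oneB X) * (Real.exp (-(R.act (K + 1) v)) * oB' K t τ v))
    (hposO' : ∀ K t, |t| ≤ l₀ → ∀ τ ∈ T K \ Bad K t, ∀ v ∈ R.dom, 0 < oA' K t τ v ∧ 0 < oB' K t τ v)
    (hRvol : R.vol ≤ vol)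
    (hS : ∀ K t, |t| ≤ l₀ → ∀ τ ∈ T K \ Bad K t, ∀ v ∈ R.dom, ∀ j ≤ K,
      |∑ X ∈ fac K t τ with C.scale X = j,
          (Real.log (Real.exp (EB (fun i => g (K + 1) (i + 1)) (uB K v) X
              - EB (fun i => g (K + 1) (i + 1)) oneB X))
            - Real.log (Real.exp (EA (g K) (uA K v) X - EA (g K) oneA X)))| ≤ S K t τ j)
    (hvol : 0 ≤ vol) (hE₀ : 0 ≤ E₀) (ha0 : 0 < a) (ha1 : a < 1)
    (hSle : ∀ K t, |t| ≤ l₀ → ∀ τ ∈ T K \ Bad K t, ∀ j ≤ K,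
      S K t τ j ≤ vol * (E₀ * ((K : ℝ) + 1) ^ m * a ^ (K - j)))
    -- (O″): the REMAINING kinds match per good term with a centre within `vol·s′` of a class constant
    (hO' : ∀ K t, |t| ≤ l₀ → ∀ τ ∈ T K \ Bad K t, ∀ v ∈ R.dom,
      |Real.log (oB' K t τ v) - Real.log (oA' K t τ v) - cO' K t τ| ≤ RO' K t τ)
    (hRO' : ∀ K t, |t| ≤ l₀ → ∀ τ ∈ T K \ Bad K t, RO' K t τ ≤ vol * rO' K) (hrO' : Summable rO')
    (hone : C.transport oneB = oneA)
    (hcO' : ∃ c₀ s : ℕ → ℝ, Summable s ∧ ∀ K t, |t| ≤ l₀ → ∀ τ ∈ T K \ Bad K t, |cO' K t τ - c₀ K| ≤ vol * s K) :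
    ∃ δ : ℕ → ℝ, NE7.Core l₀ vol T Bad A B δ ∧ Summable δ := by
  have hw : ∀ K, ∀ X ∈ All K, 0 ≤ Real.exp (-(κ * C.d X)) := fun _ _ _ => (Real.exp_pos _).le
  have hsc : ∀ K t, |t| ≤ l₀ → ∀ τ ∈ T K \ Bad K t, ∀ X ∈ fac K t τ, C.scale X ≤ K :=
    fun K t ht τ hτ X hX => hAllsc K X (hAll K t ht τ hτ hX)
  have hM : ∀ K t, |t| ≤ l₀ → ∀ τ ∈ T K \ Bad K t,
      Multiplicity (fac K t τ) C.scale (fun X => Real.exp (-(κ * C.d X))) Cw vol Λ K :=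
    fun K t ht τ hτ => multiplicity_mono (hAll K t ht τ hτ) (hw K) (hMAll K)
  have hposO : ∀ K t, |t| ≤ l₀ → ∀ τ ∈ T K \ Bad K t, ∀ v ∈ R.dom, 0 < oA K t τ v ∧ 0 < oB K t τ v :=
    fun K t ht τ hτ v hv => by
      obtain ⟨hA, hB⟩ := hposO' K t ht τ hτ v hv
      rw [hOfmtA, hOfmtB]
      exact ⟨mul_pos (Real.exp_pos _) (mul_pos (Real.exp_pos _) hA),
        mul_pos (Real.exp_pos _) (mul_pos (Real.exp_pos _) hB)⟩
  have hθ'0 : 0 < θ' := lt_of_le_of_lt (hθc.trans (le_max_right ω θc)) hθ'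
  -- N16's ActionRate conjunct: the main-action readings of consecutive runs differ by `≤ C₃θ₃^K·R.vol ≤ vol·C₃θ₃^K`
  have hact : ∀ K, ∀ v ∈ R.dom, |R.act (K + 1) v - R.act K v| ≤ vol * (C₃ * θ₃ ^ K) := fun K v hv =>
    (h16.action K v hv).trans (by
      rw [mul_comm vol]
      exact mul_le_mul_of_nonneg_left hRvol (mul_nonneg hC₃ (pow_nonneg h16.rate_nonneg K)))
  have hCb : 0 ≤ C₉ * (γ ^ 3 * Cd) * (θ' / (θ' - max ω θc)) + C₅ :=
    add_nonneg (mul_nonneg (mul_nonneg (fadingMemory_const_nonneg h22.2)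
      (mul_nonneg (pow_nonneg (box_nonneg hbox) 3) hCd)) (div_nonneg hθ'0.le (sub_pos.mpr hθ').le)) hC₅
  have hwin : ∀ K t, |t| ≤ l₀ → ∀ τ ∈ T K \ Bad K t,
      |∑ X ∈ All K \ fac K t τ, (EB (fun i => g (K + 1) (i + 1)) oneB X - EA (g K) oneA X)|
        ≤ vol * ((C₉ * (γ ^ 3 * Cd) * (θ' / (θ' - max ω θc)) + C₅) * Cw * windowSum θ' Λ (jlogOf Cl K) K) :=
    fun K t ht τ hτ =>
    abs_sum_const_le_windowSum sdiff_subset (hw K) (hMAll K)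
      (fun X hX => abs_const_sub_le_tower_of_injectedRate h22 hω h18 hθ₅ hC₅ hinj hCd hθc hbox hgA hgB hθ' hθ₅' hone K X
        (hAllsc K X (sdiff_subset hX)))
      hCb hθ'0.le (hrecent K t ht τ hτ)
  obtain ⟨c₀', s', hs', hcO''⟩ := hcO'
  refine core_summable_of_nodes_polySize_sync (oA := oA) (oB := oB)
    (cO := fun K t τ => (∑ X ∈ fac K t τ, (EB (fun i => g (K + 1) (i + 1)) oneB X - EA (g K) oneA X)) + cO' K t τ)
    (RO := fun K t τ => RO' K t τ + vol * (C₃ * θ₃ ^ K)) (rO := fun K => rO' K + C₃ * θ₃ ^ K)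
    h22 hω hU hG hPg h18 hθ₅ hC₅ h16 hC₃ hgd hinj hCd hθc hbox hgA hgB hθ' hθ₅' hθ₃' hθ'1 hθ'Λ
    hfmtA hfmtB hint hsc hposO hoff hS hM (fun K t ht τ hτ v hv => ?_) hvol hE₀ ha0 ha1 hSle
    (fun K t ht τ hτ => by rw [mul_add]; exact add_le_add (hRO' K t ht τ hτ) le_rfl)
    (hrO'.add ((summable_geometric_of_lt_one h16.rate_nonneg h16.rate_lt_one).mul_left C₃)) hone
    ⟨fun K => (∑ X ∈ All K, (EB (fun i => g (K + 1) (i + 1)) oneB X - EA (g K) oneA X)) + c₀' K, fun K =>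
      (C₉ * (γ ^ 3 * Cd) * (θ' / (θ' - max ω θc)) + C₅) * Cw * windowSum θ' Λ (jlogOf Cl K) K + s' K,
      ((summable_windowSum_log hθ'0 hθ'1 hΛ1 hCl).mul_left _).add hs', fun K t ht τ hτ => ?_⟩
  · -- `hO` for the full other kinds: constants are the added centre, the action readings a rate with centre 0
    obtain ⟨hA, hB⟩ := hposO' K t ht τ hτ v hv
    rw [hOfmtA, hOfmtB, Real.log_mul (Real.exp_pos _).ne' (mul_pos (Real.exp_pos _) hB).ne',
      Real.log_mul (Real.exp_pos _).ne' (mul_pos (Real.exp_pos _) hA).ne', Real.log_mul (Real.exp_pos _).ne' hB.ne',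
      Real.log_mul (Real.exp_pos _).ne' hA.ne', Real.log_exp, Real.log_exp, Real.log_exp, Real.log_exp, sum_sub_distrib]
    have e : (∑ X ∈ fac K t τ, EB (fun i => g (K + 1) (i + 1)) oneB X) + (-R.act (K + 1) v + Real.log (oB' K t τ v))
        - ((∑ X ∈ fac K t τ, EA (g K) oneA X) + (-R.act K v + Real.log (oA' K t τ v)))
        - ((∑ X ∈ fac K t τ, EB (fun i => g (K + 1) (i + 1)) oneB X) - (∑ X ∈ fac K t τ, EA (g K) oneA X)
          + cO' K t τ)
        = -(R.act (K + 1) v - R.act K v) + (Real.log (oB' K t τ v) - Real.log (oA' K t τ v) - cO' K t τ) := by ring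
    rw [e, add_comm (RO' K t τ)]
    exact (abs_add_le _ _).trans (add_le_add (by rw [abs_neg]; exact hact K v hv) (hO' K t ht τ hτ v hv))
  · have hsplit := sum_sdiff (f := fun X => EB (fun i => g (K + 1) (i + 1)) oneB X - EA (g K) oneA X)
      (hAll K t ht τ hτ)
    have e : (∑ X ∈ fac K t τ, (EB (fun i => g (K + 1) (i + 1)) oneB X - EA (g K) oneA X)) + cO' K t τ
        - ((∑ X ∈ All K, (EB (fun i => g (K + 1) (i + 1)) oneB X - EA (g K) oneA X)) + c₀' K)
        = -(∑ X ∈ All K \ fac K t τ, (EB (fun i => g (K + 1) (i + 1)) oneB X - EA (g K) oneA X))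
          + (cO' K t τ - c₀' K) := by
      rw [← hsplit]; ring
    rw [e, mul_add]
    refine (abs_add_le _ _).trans (add_le_add ?_ (hcO'' K t ht τ hτ))
    rw [abs_neg]
    exact hwin K t ht τ hτ

/-! ## §2 Non-vacuity of §1 on the tree's toy nodes, U2-OUTPUT letter -/

section Sanity

/-- **NON-VACUITY OF THE KNIT v3, U2-OUTPUT LETTER.**  The tree's toy nodes (`T4TowerRateComposition.toy_nonvacuous`: NE9,
fading memory, Lipschitz-in-U, NE5 with any `C₅ ≥ 0`; `T4TowerRateDischarge.toy_nodes_hypotheses`: NE3's local rate, gauge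
domination, node U2's OUTPUT with `Cd = 0` for CONSTANT coupling tables `γ`, the box, polynomial growth) with one good term per
cutoff over the one-point field space, E-ledger = reference ledger `range (K+1)`, zero-centred size `(1 − q)q^{K+j}`, other kinds
`1 = exp(Σ E(·;0))·exp(−Σ E(·;0))`, identity transport, zero action readings, meet ALL binders of `core_summable_of_nodes_window`, and the knit fires.
Consistency of the binder SET only; no physics. [folklore] -/
theorem nodes_window_nonvacuous {q γ C₅ : ℝ} (hq0 : 0 < q) (hq1 : q < 1) (hγ : 0 < γ) (hC₅ : 0 ≤ C₅) :
    ∃ δ : ℕ → ℝ, NE7.Core (ι := Unit) 1 1 (fun _ => Finset.univ) (fun _ _ => ∅)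
        (fun K _ _ => ∫ _v, (∏ X ∈ range (K + 1),
          Real.exp (toyEA q q (fun _ => γ) (q ^ K) X - toyEA q q (fun _ => γ) 0 X)) * 1 ∂(Measure.dirac ()))
        (fun K _ _ => ∫ _v, (∏ X ∈ range (K + 1),
          Real.exp (toyEB q q C₅ (fun _ => γ) (q ^ (K + 1)) X - toyEB q q C₅ (fun _ => γ) 0 X)) * 1
          ∂(Measure.dirac ()))
        δ ∧ Summable δ := by
  obtain ⟨h9, hΛ, hU, h5⟩ := toy_nonvacuous (C₅ := C₅) hq0.le hq1.le hq0.le hC₅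
  obtain ⟨hloc, hgd, hinj, hbox, hG⟩ := toy_nodes_hypotheses (θc := q) (γ := γ) hq0.le hq1.le hγ
  have h16 : NE3Shape
      ({ dom := Set.univ, act := fun _ _ => 0, loc := fun k _ _ => q ^ k, vol := 0, vol_nonneg := le_rfl } :
        Readings Unit Unit) 1 q :=
    { rate_nonneg := hq0.le, rate_lt_one := hq1, action := fun k V _ => by simp, pointwise := hloc }
  have hθ' : max q q < (1 + q) / 2 := by rw [max_self]; linarith
  have hqθ' : q ≤ (1 + q) / 2 := by linarith
  have hθ'1 : (1 + q) / 2 < 1 := by linarith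
  refine core_summable_of_nodes_window (C := toyCarriers) (σ := Unit) (W := Set.univ) (EA := toyEA q q)
    (EB := toyEB q q C₅) (Λm := fun k i => q ^ (k - i)) (CU := fun _ _ => (1 : ℝ)) (g := fun _ _ => γ)
    (uA := fun K _ => (q ^ K : ℝ)) (uB := fun K _ => (q ^ (K + 1) : ℝ)) (oneA := (0 : ℝ)) (oneB := (0 : ℝ))
    (oA := fun _ _ _ _ => 1) (oB := fun _ _ _ _ => 1)
    (oA' := fun K _ _ _ => Real.exp (-(∑ X ∈ range (K + 1), toyEA q q (fun _ => γ) 0 X)))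
    (oB' := fun K _ _ _ => Real.exp (-(∑ X ∈ range (K + 1), toyEB q q C₅ (fun _ => γ) 0 X)))
    (μ := fun _ _ _ => Measure.dirac ()) (fac := fun K _ _ => range (K + 1)) (All := fun K => range (K + 1))
    (S := fun K _ _ j => (1 - q) * q ^ (K + j))
    (cO' := fun K _ _ => Real.log (Real.exp (-(∑ X ∈ range (K + 1), toyEB q q C₅ (fun _ => γ) 0 X)))
      - Real.log (Real.exp (-(∑ X ∈ range (K + 1), toyEA q q (fun _ => γ) 0 X))))
    (RO' := fun _ _ _ => 0) (rO' := fun _ => 0)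
    (Cw := 1) (E₀ := 1) (a := q) (Λ := 1) (Cl := 0) (m := 0) (κ := 0) (Pg := 1) (q := 0)
    h16 zero_le_one hgd h5 hq0.le hC₅ ⟨h9, hΛ⟩ hq0.le hinj le_rfl hq0.le hbox hU hG zero_le_one
    (fun _ => Set.mem_univ _) (fun _ => Set.mem_univ _) hθ' hqθ' hqθ' hθ'1 hθ'1.le le_rfl
    (fun _ _ _ => rfl) (fun _ _ _ => rfl) (fun _ _ _ _ _ => ⟨Integrable.of_finite, Integrable.of_finite⟩)
    (fun _ _ _ _ _ v hv => absurd (Set.mem_univ v) hv)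
    (fun _ _ _ _ _ => Finset.Subset.refl _) (fun K X hX => Nat.le_of_lt_succ (mem_range.mp hX)) (fun K j hj => ?_)
    le_rfl (fun K _ _ _ _ X hX => absurd hX (by simp))
    (fun K _ _ _ => by dsimp only; rw [neg_zero, Real.exp_zero, one_mul, ← Real.exp_add, add_neg_cancel, Real.exp_zero])
    (fun K _ _ _ => by dsimp only; rw [neg_zero, Real.exp_zero, one_mul, ← Real.exp_add, add_neg_cancel, Real.exp_zero])
    (fun _ _ _ _ _ _ _ => ⟨Real.exp_pos _, Real.exp_pos _⟩) zero_le_one (fun K t _ τ _ v _ j hj => ?_)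
    zero_le_one zero_le_one hq0 hq1 (fun K t _ τ _ j hj => ?_)
    (fun _ _ _ _ _ _ _ => by simp) (fun _ _ _ _ _ => by simp) summable_zero rfl
    ⟨fun K => Real.log (Real.exp (-(∑ X ∈ range (K + 1), toyEB q q C₅ (fun _ => γ) 0 X)))
      - Real.log (Real.exp (-(∑ X ∈ range (K + 1), toyEA q q (fun _ => γ) 0 X))),
      fun _ => 0, summable_zero, fun K t _ τ _ => by simp⟩
  · -- `hMAll`: one domain per scale, weight `e^0 = 1 ≤ 1·1·1^{K−j}`
    show ∑ i ∈ range (K + 1) with i = j, Real.exp (-(0 * (0 : ℝ))) ≤ 1 * 1 * (1 : ℝ) ^ (K - j)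
    rw [Finset.filter_eq', if_pos (mem_range.mpr (Nat.lt_succ_of_le hj)), sum_singleton]
    simp
  · -- `hS`: the zero-centred toy slice is `q^j(q^{K+1} − q^K)`, of size `(1 − q)q^{K+j}`
    show |∑ X ∈ range (K + 1) with X = j,
        (Real.log (Real.exp (toyEB q q C₅ (fun _ => γ) (q ^ (K + 1)) X - toyEB q q C₅ (fun _ => γ) 0 X))
          - Real.log (Real.exp (toyEA q q (fun _ => γ) (q ^ K) X - toyEA q q (fun _ => γ) 0 X)))|
      ≤ (1 - q) * q ^ (K + j)
    rw [Finset.filter_eq', if_pos (mem_range.mpr (Nat.lt_succ_of_le hj)), sum_singleton, Real.log_exp,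
      Real.log_exp]
    simp only [toyEA, toyEB]
    have e : q ^ j * q ^ (K + 1) + ∑ i ∈ range j, q ^ (j - i) * γ - C₅ * q ^ j
        - (q ^ j * 0 + ∑ i ∈ range j, q ^ (j - i) * γ - C₅ * q ^ j)
        - (q ^ j * q ^ K + ∑ i ∈ range j, q ^ (j - i) * γ - (q ^ j * 0 + ∑ i ∈ range j, q ^ (j - i) * γ))
        = -((1 - q) * q ^ (K + j)) := by ring
    rw [e, abs_neg, abs_of_nonneg (mul_nonneg (by linarith) (pow_nonneg hq0.le _))]
  · -- `hSle`: `(1 − q)q^{K+j} ≤ 1·(1·(K+1)^0·q^{K−j})`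
    show (1 - q) * q ^ (K + j) ≤ 1 * (1 * ((K : ℝ) + 1) ^ 0 * q ^ (K - j))
    rw [pow_zero, one_mul, one_mul, one_mul]
    exact (mul_le_of_le_one_left (pow_nonneg hq0.le _) (by linarith)).trans
      (pow_le_pow_of_le_one hq0.le hq1.le (by omega))

end Sanity

end Summit.QuantumFields.YangMills.BalabanUVNodes.N19ConstantsWindowU2Output
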